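import Mathlib.Tactic.NormNum.Prime
import Literature.Barriers.AtomisticToContinuum.CohnElkiesNotSharp3DBridge
import HarnessLib

/-!
# The Cohn–Elkies bound is not sharp in `ℝ³` (Li 2022) — discharge of the `d = 3` certificate

Proves `Li2022_dualCertificate53_holds : Li2022_dualCertificate53` (the computational content of
R. Li, arXiv:2206.09876, Theorem 3: a feasible point of the radialized discrete dual Cohn–Elkies
linear program on `ℤ₅₃³` with `r² = 89` and objective `> 0.18398089`), hence the barrier fact
`Li2022_cohnElkies3D` via `Li2022_cohnElkies3D_of_dualCertificate53` (`CohnElkiesNotSharp3DProofs.lean`).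

## Proof architecture

The certificate is `ν = nuNat` (`CohnElkiesNotSharp3DData.lean`), a non-negative integer function on
`ℤ₅₃³`, even in each coordinate. The conditions of `IsDiscreteDualCertificate 89 ν` are:
`ν = 0` on the shell (kernel test `shellOK`), `ν(0) > 0`, and `Re ν̂(y) ≥ 0` for all `y`. For the
last one, `y ≠ 0` is written (after coordinate sign changes and `y ↦ -y`, which do not change
`Re ν̂(y)`) as `t u` with `t ∈ {1,…,26}` and `u ∈ {(1,a,b), (0,1,a), (0,0,1)}`, `a, b ≤ 26`; then
`2^48 Re ν̂(t u) ≥ ∑_x ν(x) (C⁺ - C⁻)(t⟨x,u⟩) = ∑_x ν(x) C⁰(t⟨x,u⟩) - 2^48 ∑_x ν(x)` by the certified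
cosine bounds, and the kernel verified `2^48 · total ≤ ∑_x ν(x) C⁰(t⟨x,u⟩)` (`verdicts`), the sum
being read off three base-`2^128` digits of the product of the packed accumulator
`∑_x ν(x) 2^{128 E(x)}` (`E(x) ≡ ⟨x,u⟩ (mod 53)`, `E ≤ 156`) with the packed cosine row
(`dot3_packed`, a digit-extraction lemma of `CohnElkiesNotSharp3DBridge.lean`, where the loop
programs of `CohnElkiesNotSharp3DData.lean` are identified with these `Finset` sums and the line
positivity `re_nonneg_of_checkAcc` is derived). The objective inequality is the integer comparison
`4³ 53⁶ ν(0)² 18398089² < 89³ (∑ν)² 10¹⁶`. As a corollary the barrier fact itself is discharged: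
`Li2022_cohnElkies3D_holds`.

## Sources

R. Li, arXiv:2206.09876 (2022), §4 Problem 3 (p. 8), §5 (p. 9), §6 Theorem 3 (p. 10). The
verification scheme (projections along lines, packed arithmetic): this formalization. [folklore]
-/

noncomputable section

namespace Literature.Barriers.AtomisticToContinuum

open Finset Complex
open scoped Real BigOperators

/-! ## §5 Symmetries of the character sum

`Re ν̂(y) = (∑ x, ((ν x : ℝ) : ℂ) * ψ(⟨x,y⟩)).re` is written out in full everywhere (never wrapped in
a definition): the sum ranges over the concrete finite type `ℤ₅₃³`, and a definitional unfolding of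
a wrapper against `Complex.re` of the sum would make the kernel evaluate the `148877`-term sum
symbolically. -/

/-- `Re ν̂(-y) = Re ν̂(y)` (`ν` is real). [folklore] -/
theorem reLam_neg (y : (Fin 3 → ZMod 53)) : (∑ x : Fin 3 → ZMod 53, ((nuNat x : ℝ) : ℂ) * ZMod.stdAddChar (x ⬝ᵥ (-y))).re = (∑ x : Fin 3 → ZMod 53, ((nuNat x : ℝ) : ℂ) * ZMod.stdAddChar (x ⬝ᵥ (y))).re := by
  have h : (∑ x : (Fin 3 → ZMod 53), ((nuNat x : ℝ) : ℂ) * ZMod.stdAddChar (x ⬝ᵥ (-y))) =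
      starRingEnd ℂ (∑ x : (Fin 3 → ZMod 53), ((nuNat x : ℝ) : ℂ) * ZMod.stdAddChar (x ⬝ᵥ y)) := by
    rw [map_sum]
    refine sum_congr rfl fun x _ => ?_
    rw [map_mul, Complex.conj_ofReal, dotProduct_neg, conj_stdAddChar]
  rw [h, Complex.conj_re]

/-- Changing the sign of coordinate `i` twice is the identity. [folklore] -/
theorem flip_flip (i : Fin 3) (x : Fin 3 → ZMod 53) :
    Function.update (Function.update x i (-x i)) i (-Function.update x i (-x i) i) = x := by
  rw [Function.update_self, Function.update_idem, neg_neg, Function.update_eq_self]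

/-- Changing the sign of coordinate `i` in both arguments preserves the pairing. [folklore] -/
theorem flip_dotProduct (i : Fin 3) (x y : Fin 3 → ZMod 53) :
    Function.update x i (-x i) ⬝ᵥ Function.update y i (-y i) = x ⬝ᵥ y := by
  fin_cases i <;> simp [dotProduct, Fin.sum_univ_three]

/-- `ν̂` is invariant under changing the sign of one coordinate (reindex by the involution, `ν` being
even in each coordinate). [folklore] -/
theorem charSum_flipAt (i : Fin 3) (y : Fin 3 → ZMod 53) :
    (∑ x : Fin 3 → ZMod 53, ((nuNat x : ℝ) : ℂ) * ZMod.stdAddChar (x ⬝ᵥ Function.update y i (-y i))) =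
      ∑ x : Fin 3 → ZMod 53, ((nuNat x : ℝ) : ℂ) * ZMod.stdAddChar (x ⬝ᵥ y) := by
  rw [← Equiv.sum_comp (Function.Involutive.toPerm (fun x : Fin 3 → ZMod 53 => Function.update x i (-x i))
    (flip_flip i)) (fun x => ((nuNat x : ℝ) : ℂ) * ZMod.stdAddChar (x ⬝ᵥ Function.update y i (-y i)))]
  refine sum_congr rfl fun x _ => ?_
  show ((nuNat (Function.update x i (-x i)) : ℝ) : ℂ) *
      ZMod.stdAddChar (Function.update x i (-x i) ⬝ᵥ Function.update y i (-y i)) = _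
  rw [nuNat_update_neg, flip_dotProduct]

/-- `Re ν̂` is invariant under changing the sign of one coordinate. [folklore] -/
theorem reLam_flipAt (i : Fin 3) (y : Fin 3 → ZMod 53) :
    (∑ x : Fin 3 → ZMod 53, ((nuNat x : ℝ) : ℂ) * ZMod.stdAddChar (x ⬝ᵥ (Function.update y i (-y i)))).re = (∑ x : Fin 3 → ZMod 53, ((nuNat x : ℝ) : ℂ) * ZMod.stdAddChar (x ⬝ᵥ (y))).re := by
  rw [charSum_flipAt]

/-- `Re ν̂(0) ≥ 0`. [folklore] -/
theorem reLam_zero : 0 ≤ (∑ x : Fin 3 → ZMod 53, ((nuNat x : ℝ) : ℂ) * ZMod.stdAddChar (x ⬝ᵥ ((0 : (Fin 3 → ZMod 53))))).re := by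
  rw [re_charSum]
  exact sum_nonneg fun x _ => by
    rw [dotProduct_zero, ZMod.val_zero, Nat.cast_zero, mul_zero, zero_div, Real.cos_zero, mul_one]
    exact Nat.cast_nonneg _

/-! ## §6 The three families of lines -/

/-- `z = |z|` or `z = -|z|` in `ℤ₅₃`. [folklore] -/
theorem eq_or_eq_neg_absZ (z : ZMod 53) : z = (absZ z : ZMod 53) ∨ z = -(absZ z : ZMod 53) := by
  unfold absZ
  rcases Int.natAbs_eq z.valMinAbs with h' | h'
  · left
    have e := congrArg (fun w : ℤ => (w : ZMod 53)) h'
    simp only [Int.cast_natCast, ZMod.coe_valMinAbs] at e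
    exact e
  · right
    have e := congrArg (fun w : ℤ => (w : ZMod 53)) h'
    simp only [Int.cast_neg, Int.cast_natCast, ZMod.coe_valMinAbs] at e
    exact e

/-- A non-zero `t ∈ ℤ₅₃` is `±t'` with `1 ≤ t' ≤ 26`. [folklore] -/
theorem exists_abs_of_ne_zero {t : ZMod 53} (ht : t ≠ 0) :
    ∃ t' : ℕ, 1 ≤ t' ∧ t' ≤ 26 ∧ (t = (t' : ZMod 53) ∨ t = -(t' : ZMod 53)) := by
  refine ⟨absZ t, ?_, absZ_le t, eq_or_eq_neg_absZ t⟩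
  rcases Nat.eq_zero_or_pos (absZ t) with h | h
  · exact absurd (absZ_eq_zero.1 h) ht
  · exact h

/-- Membership in the loop ranges of the kernel tests. [folklore] -/
theorem mem_range'_of_le {a : ℕ} (ha : a ≤ 26) : a ∈ List.range' 0 27 ∧ a ∈ List.range 27 := by
  refine ⟨?_, List.mem_range.2 (by omega)⟩
  rw [List.mem_range'_1]
  omega

/-- `E₁(x) = x₀ + (a x₁ mod 53) + (b x₂ mod 53) ≡ ⟨x, (1,a,b)⟩`. [folklore] -/
theorem E1_cast (a b : ℕ) (x : Fin 3 → ZMod 53) :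
    (((x 0).val + a * (x 1).val % 53 + b * (x 2).val % 53 : ℕ) : ZMod 53) =
      x ⬝ᵥ ![1, (a : ZMod 53), (b : ZMod 53)] := by
  simp only [dotProduct, Fin.sum_univ_three, Matrix.cons_val_zero, Matrix.cons_val_one,
    Matrix.cons_val_two, Matrix.head_cons, Matrix.tail_cons, Nat.cast_add, ZMod.natCast_mod,
    Nat.cast_mul, ZMod.natCast_val, ZMod.cast_id', id_eq]
  ring

/-- `E₂(x) = x₁ + (a x₂ mod 53) ≡ ⟨x, (0,1,a)⟩`. [folklore] -/
theorem E2_cast (a : ℕ) (x : Fin 3 → ZMod 53) :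
    (((x 1).val + a * (x 2).val % 53 : ℕ) : ZMod 53) = x ⬝ᵥ ![0, 1, (a : ZMod 53)] := by
  simp only [dotProduct, Fin.sum_univ_three, Matrix.cons_val_zero, Matrix.cons_val_one,
    Matrix.cons_val_two, Matrix.head_cons, Matrix.tail_cons, Nat.cast_add, ZMod.natCast_mod,
    Nat.cast_mul, ZMod.natCast_val, ZMod.cast_id', id_eq]
  ring

/-- `E₃(x) = x₂ ≡ ⟨x, (0,0,1)⟩`. [folklore] -/
theorem E3_cast (x : Fin 3 → ZMod 53) : (((x 2).val : ℕ) : ZMod 53) = x ⬝ᵥ ![0, 0, 1] := by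
  simp only [dotProduct, Fin.sum_univ_three, Matrix.cons_val_zero, Matrix.cons_val_one,
    Matrix.cons_val_two, Matrix.head_cons, Matrix.tail_cons, ZMod.natCast_val, ZMod.cast_id', id_eq]
  ring

/-- `E₁ ≤ 156`. [folklore] -/
theorem E1_le (a b : ℕ) (x : Fin 3 → ZMod 53) : (x 0).val + a * (x 1).val % 53 + b * (x 2).val % 53 ≤ 156 := by
  have h0 := ZMod.val_lt (x 0)
  have h1 : a * (x 1).val % 53 < 53 := Nat.mod_lt _ (by norm_num)
  have h2 : b * (x 2).val % 53 < 53 := Nat.mod_lt _ (by norm_num)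
  omega

/-- `E₂ ≤ 156`. [folklore] -/
theorem E2_le (a : ℕ) (x : Fin 3 → ZMod 53) : (x 1).val + a * (x 2).val % 53 ≤ 156 := by
  have h1 := ZMod.val_lt (x 1)
  have h2 : a * (x 2).val % 53 < 53 := Nat.mod_lt _ (by norm_num)
  omega

/-- `E₃ ≤ 156`. [folklore] -/
theorem E3_le (x : Fin 3 → ZMod 53) : (x 2).val ≤ 156 := by
  have h2 := ZMod.val_lt (x 2)
  omega

/-- Type 1, canonical parameters: `Re ν̂(t (1,a,b)) ≥ 0` for `a, b ≤ 26`, `1 ≤ t ≤ 26` (kernel).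
[folklore] -/
theorem reLam_line1 {a b t : ℕ} (ha : a ≤ 26) (hb : b ≤ 26) (ht1 : 1 ≤ t) (ht2 : t ≤ 26) :
    0 ≤ (∑ x : Fin 3 → ZMod 53, ((nuNat x : ℝ) : ℂ) * ZMod.stdAddChar (x ⬝ᵥ ((t : ZMod 53) • ![1, (a : ZMod 53), (b : ZMod 53)]))).re := by
  have hchk : checkAcc (acc1 a b) = true :=
    List.all_eq_true.1 (List.all_eq_true.1 verdicts.1 a (mem_range'_of_le ha).1) b (mem_range'_of_le hb).2
  exact re_nonneg_of_checkAcc (fun x => (x 0).val + a * (x 1).val % 53 + b * (x 2).val % 53) (E1_le a b)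
    ![1, (a : ZMod 53), (b : ZMod 53)] (E1_cast a b) (acc1_eq a b) hchk ht1 ht2

/-- Type 2, canonical parameters: `Re ν̂(t (0,1,a)) ≥ 0` for `a ≤ 26`, `1 ≤ t ≤ 26` (kernel).
[folklore] -/
theorem reLam_line2 {a t : ℕ} (ha : a ≤ 26) (ht1 : 1 ≤ t) (ht2 : t ≤ 26) :
    0 ≤ (∑ x : Fin 3 → ZMod 53, ((nuNat x : ℝ) : ℂ) * ZMod.stdAddChar (x ⬝ᵥ ((t : ZMod 53) • ![0, 1, (a : ZMod 53)]))).re := by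
  have hchk : checkAcc (acc2 a) = true := List.all_eq_true.1 verdicts.2.1 a (mem_range'_of_le ha).2
  exact re_nonneg_of_checkAcc (fun x => (x 1).val + a * (x 2).val % 53) (E2_le a) ![0, 1, (a : ZMod 53)]
    (E2_cast a) (acc2_eq a) hchk ht1 ht2

/-- Type 3: `Re ν̂(t (0,0,1)) ≥ 0` for `1 ≤ t ≤ 26` (kernel). [folklore] -/
theorem reLam_line3 {t : ℕ} (ht1 : 1 ≤ t) (ht2 : t ≤ 26) :
    0 ≤ (∑ x : Fin 3 → ZMod 53, ((nuNat x : ℝ) : ℂ) * ZMod.stdAddChar (x ⬝ᵥ ((t : ZMod 53) • ![0, 0, 1]))).re :=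
  re_nonneg_of_checkAcc (fun x => (x 2).val) E3_le ![0, 0, 1] E3_cast acc3_eq verdicts.2.2.1 ht1 ht2

/-- Flipping coordinate `1` of `t (1,a,b)` negates `a`. [folklore] -/
theorem flip_one_line1 (t a b : ZMod 53) :
    Function.update (t • ![1, a, b]) 1 (-(t • ![1, a, b]) 1) = t • ![1, -a, b] := by
  funext i; fin_cases i <;> simp [Function.update]

/-- Flipping coordinate `2` of `t (1,a,b)` negates `b`. [folklore] -/
theorem flip_two_line1 (t a b : ZMod 53) :
    Function.update (t • ![1, a, b]) 2 (-(t • ![1, a, b]) 2) = t • ![1, a, -b] := by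
  funext i; fin_cases i <;> simp [Function.update]

/-- Flipping coordinate `2` of `t (0,1,a)` negates `a`. [folklore] -/
theorem flip_two_line2 (t a : ZMod 53) :
    Function.update (t • ![0, 1, a]) 2 (-(t • ![0, 1, a]) 2) = t • ![0, 1, -a] := by
  funext i; fin_cases i <;> simp [Function.update]

/-- Type 1, any slopes: `Re ν̂(t (1,a,b)) ≥ 0` for `1 ≤ t ≤ 26`. [folklore] -/
theorem reLam_line1' (a b : ZMod 53) {t : ℕ} (ht1 : 1 ≤ t) (ht2 : t ≤ 26) :
    0 ≤ (∑ x : Fin 3 → ZMod 53, ((nuNat x : ℝ) : ℂ) * ZMod.stdAddChar (x ⬝ᵥ ((t : ZMod 53) • ![1, a, b]))).re := by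
  -- reduce `b` to `|b|`
  have hb : 0 ≤ (∑ x : Fin 3 → ZMod 53, ((nuNat x : ℝ) : ℂ) * ZMod.stdAddChar (x ⬝ᵥ ((t : ZMod 53) • ![1, a, (absZ b : ZMod 53)]))).re →
      0 ≤ (∑ x : Fin 3 → ZMod 53, ((nuNat x : ℝ) : ℂ) * ZMod.stdAddChar (x ⬝ᵥ ((t : ZMod 53) • ![1, a, b]))).re := by
    intro h
    rcases eq_or_eq_neg_absZ b with e | e
    · rw [e]; exact h
    · rw [e, ← flip_two_line1, reLam_flipAt]; exact h
  apply hb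
  -- reduce `a` to `|a|`
  rcases eq_or_eq_neg_absZ a with e | e
  · rw [e]; exact reLam_line1 (absZ_le a) (absZ_le b) ht1 ht2
  · rw [e, ← flip_one_line1, reLam_flipAt]; exact reLam_line1 (absZ_le a) (absZ_le b) ht1 ht2

/-- Type 2, any slope: `Re ν̂(t (0,1,a)) ≥ 0` for `1 ≤ t ≤ 26`. [folklore] -/
theorem reLam_line2' (a : ZMod 53) {t : ℕ} (ht1 : 1 ≤ t) (ht2 : t ≤ 26) :
    0 ≤ (∑ x : Fin 3 → ZMod 53, ((nuNat x : ℝ) : ℂ) * ZMod.stdAddChar (x ⬝ᵥ ((t : ZMod 53) • ![0, 1, a]))).re := by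
  rcases eq_or_eq_neg_absZ a with e | e
  · rw [e]; exact reLam_line2 (absZ_le a) ht1 ht2
  · rw [e, ← flip_two_line2, reLam_flipAt]; exact reLam_line2 (absZ_le a) ht1 ht2

/-- Any non-zero multiple: from `t = ±t'` and `Re ν̂(-y) = Re ν̂(y)`. [folklore] -/
theorem reLam_smul_of_abs (u : (Fin 3 → ZMod 53)) (h : ∀ t' : ℕ, 1 ≤ t' → t' ≤ 26 → 0 ≤ (∑ x : Fin 3 → ZMod 53, ((nuNat x : ℝ) : ℂ) * ZMod.stdAddChar (x ⬝ᵥ ((t' : ZMod 53) • u))).re)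
    {t : ZMod 53} (ht : t ≠ 0) : 0 ≤ (∑ x : Fin 3 → ZMod 53, ((nuNat x : ℝ) : ℂ) * ZMod.stdAddChar (x ⬝ᵥ (t • u))).re := by
  obtain ⟨t', h1, h2, e | e⟩ := exists_abs_of_ne_zero ht
  · rw [e]; exact h t' h1 h2
  · rw [e, neg_smul, reLam_neg]; exact h t' h1 h2

/-- **Positivity of `Re ν̂` everywhere.** [folklore] -/
theorem reLam_nonneg (y : (Fin 3 → ZMod 53)) : 0 ≤ (∑ x : Fin 3 → ZMod 53, ((nuNat x : ℝ) : ℂ) * ZMod.stdAddChar (x ⬝ᵥ (y))).re := by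
  haveI : Fact (Nat.Prime 53) := ⟨by norm_num⟩
  by_cases h0 : y 0 = 0
  · by_cases h1 : y 1 = 0
    · by_cases h2 : y 2 = 0
      · have hy : y = 0 := by funext i; fin_cases i <;> assumption
        rw [hy]; exact reLam_zero
      · -- type 3: y = y₂ (0,0,1)
        have hy : y = y 2 • ![0, 0, 1] := by
          funext i; fin_cases i <;> simp [h0, h1]
        rw [hy]
        exact reLam_smul_of_abs _ (fun t' h1' h2' => reLam_line3 h1' h2') h2
    · -- type 2: y = y₁ (0,1,a)
      obtain ⟨a, ha⟩ : ∃ a : ZMod 53, y 1 * a = y 2 := ⟨(y 1)⁻¹ * y 2, mul_inv_cancel_left₀ h1 _⟩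
      have hy : y = y 1 • ![0, 1, a] := by
        funext i; fin_cases i <;> simp [h0, ha]
      rw [hy]
      exact reLam_smul_of_abs _ (fun t' h1' h2' => reLam_line2' a h1' h2') h1
  · -- type 1: y = y₀ (1,a,b)
    obtain ⟨a, ha⟩ : ∃ a : ZMod 53, y 0 * a = y 1 := ⟨(y 0)⁻¹ * y 1, mul_inv_cancel_left₀ h0 _⟩
    obtain ⟨b, hb⟩ : ∃ b : ZMod 53, y 0 * b = y 2 := ⟨(y 0)⁻¹ * y 2, mul_inv_cancel_left₀ h0 _⟩
    have hy : y = y 0 • ![1, a, b] := by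
      funext i; fin_cases i <;> simp [ha, hb]
    rw [hy]
    exact reLam_smul_of_abs _ (fun t' h1' h2' => reLam_line1' a b h1' h2') h0

/-! ## §7 Assembly -/

/-- The objective inequality in integers (kernel). [folklore] -/
theorem bound_ineq : 4 ^ 3 * 53 ^ 6 * nu0Lit ^ 2 * 18398089 ^ 2 < 89 ^ 3 * totalLit ^ 2 * 100000000 ^ 2 := by
  decide +kernel

/-- From the integer inequality to the real bound (cf. `lt_discreteDualBound_certNu`). [folklore] -/
theorem lt_discreteDualBound_of {ν : (Fin 3 → ZMod 53) → ℝ} {N0 T Tn Td : ℕ} (hN : ν 0 = N0) (hT : ∑ x, ν x = T)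
    (h0 : 0 < N0) (hTd : 0 < Td) (h : 4 ^ 3 * 53 ^ 6 * N0 ^ 2 * Tn ^ 2 < 89 ^ 3 * T ^ 2 * Td ^ 2) :
    (Tn / Td : ℝ) < discreteDualBound 89 ν := by
  rw [discreteDualBound, hN, hT]
  have h89 : ((89 : ℕ) : ℝ) = 89 := by norm_num
  have h53 : ((53 : ℕ) : ℝ) = 53 := by norm_num
  rw [h89, h53]
  have hN0 : (0 : ℝ) < N0 := by exact_mod_cast h0
  have hTd' : (0 : ℝ) < Td := by exact_mod_cast hTd
  have hs : 0 ≤ Real.sqrt 89 := Real.sqrt_nonneg _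
  have hb : 0 ≤ (Real.sqrt 89 / 2) ^ 3 / (53 : ℝ) ^ 3 * ((T : ℝ) / N0) :=
    mul_nonneg (div_nonneg (pow_nonneg (div_nonneg hs (by norm_num)) 3) (by norm_num))
      (div_nonneg (Nat.cast_nonneg _) hN0.le)
  refine lt_of_pow_lt_pow_left₀ 2 hb ?_
  have h' : (4 : ℝ) ^ 3 * (53 : ℝ) ^ 6 * (N0 : ℝ) ^ 2 * (Tn : ℝ) ^ 2 < (89 : ℝ) ^ 3 * (T : ℝ) ^ 2 * (Td : ℝ) ^ 2 := by
    exact_mod_cast h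
  have hsq : ((Real.sqrt 89 / 2) ^ 3 / (53 : ℝ) ^ 3 * ((T : ℝ) / N0)) ^ 2 =
      (89 : ℝ) ^ 3 * (T : ℝ) ^ 2 / ((4 : ℝ) ^ 3 * (53 : ℝ) ^ 6 * (N0 : ℝ) ^ 2) := by
    have hR : (Real.sqrt 89) ^ 2 = 89 := Real.sq_sqrt (by norm_num)
    have hR6 : (Real.sqrt 89) ^ 6 = 89 ^ 3 := by rw [show 6 = 2 * 3 by norm_num, pow_mul, hR]
    field_simp
    rw [hR6]
    ring
  rw [hsq, div_pow, div_lt_div_iff₀ (by positivity) (by positivity)]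
  nlinarith

/-- The value at the origin. [folklore] -/
theorem nuNat_zero : nuNat 0 = nu0Lit := by
  rw [← verdicts.2.2.2.2.2]
  rfl

/-- The certificate vanishes on the shell `0 < |x|² < 89`. [folklore] -/
theorem nuNat_eq_zero_of_lt {x : (Fin 3 → ZMod 53)} (hx : x ≠ 0) (hlt : zmodSqNorm x < 89) : nuNat x = 0 := by
  have hsq : zmodSqNorm x =
      absZ (x 0) * absZ (x 0) + absZ (x 1) * absZ (x 1) + absZ (x 2) * absZ (x 2) := by
    simp only [zmodSqNorm, Fin.sum_univ_three, absZ, sq]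
  have hne : absZ (x 0) * absZ (x 0) + absZ (x 1) * absZ (x 1) + absZ (x 2) * absZ (x 2) ≠ 0 := by
    intro h
    apply hx
    have h0 : absZ (x 0) = 0 := by nlinarith [Nat.zero_le (absZ (x 0) * absZ (x 0))]
    have h1 : absZ (x 1) = 0 := by nlinarith [Nat.zero_le (absZ (x 1) * absZ (x 1))]
    have h2 : absZ (x 2) = 0 := by nlinarith [Nat.zero_le (absZ (x 2) * absZ (x 2))]
    funext i
    fin_cases i
    · exact absZ_eq_zero.1 h0
    · exact absZ_eq_zero.1 h1
    · exact absZ_eq_zero.1 h2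
  have hall := verdicts.2.2.2.1
  have h := List.all_eq_true.1 (List.all_eq_true.1 (List.all_eq_true.1 hall (absZ (x 0))
    (List.mem_range.2 (by have := absZ_le (x 0); omega))) (absZ (x 1))
    (List.mem_range.2 (by have := absZ_le (x 1); omega))) (absZ (x 2))
    (List.mem_range.2 (by have := absZ_le (x 2); omega))
  simp only [Bool.or_eq_true, beq_iff_eq] at h
  rcases h with (h | h) | h
  · exact absurd h hne
  · have := Nat.le_of_ble_eq_true h
    omega
  · exact h

/-- **Li's `d = 3` certificate holds** (Li 2022, Theorem 3: a feasible point of the radialized discrete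
dual Cohn–Elkies linear program on `ℤ₅₃³` with `r = √89` and objective `> 0.18398089`), discharged by
the integer certificate `nuNat` and the kernel computation `verdicts`.
[cite: Li2022, §6 Theorem 3 (p. 10)] -/
theorem Li2022_dualCertificate53_holds : Li2022_dualCertificate53 := by
  refine ⟨fun x => (nuNat x : ℝ), ⟨fun x => Nat.cast_nonneg _, ?_, ?_, ?_⟩, ?_⟩
  · intro x hx hlt
    show ((nuNat x : ℕ) : ℝ) = 0
    rw [nuNat_eq_zero_of_lt hx hlt, Nat.cast_zero]
  · intro y
    exact reLam_nonneg y
  · show (0 : ℝ) < (nuNat 0 : ℝ)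
    rw [nuNat_zero]
    exact_mod_cast Nat.pos_of_ne_zero (by decide)
  · have hT : ∑ x : (Fin 3 → ZMod 53), (nuNat x : ℝ) = (totalLit : ℝ) := by
      rw [← verdicts.2.2.2.2.1, total_eq_sum, Nat.cast_sum]
    have h := lt_discreteDualBound_of (ν := fun x => (nuNat x : ℝ)) (Tn := 18398089) (Td := 100000000)
      (by show ((nuNat 0 : ℕ) : ℝ) = (nu0Lit : ℝ); rw [nuNat_zero]) hT
      (Nat.pos_of_ne_zero (by decide)) (by norm_num) bound_ineq
    push_cast at h
    exact h

/-- **The barrier fact holds**: the three-dimensional Cohn–Elkies linear programming bound exceeds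
`0.18398089 > 2^{-5/2}` (Li 2022, Theorem 3), now unconditionally: Li's discrete reduction
(`Li2022_cohnElkies3D_of_dualCertificate53`) applied to the kernel-checked certificate.
[cite: Li2022, §6 Theorem 3 (p. 10)] -/
theorem Li2022_cohnElkies3D_holds : Li2022_cohnElkies3D :=
  Li2022_cohnElkies3D_of_dualCertificate53 Li2022_dualCertificate53_holds

end Literature.Barriers.AtomisticToContinuum

end
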